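import Mathlib
import HarnessLib
import Summits.AnomalousDissipation.AnomalousDissipation.Theses.DyadicWallCascade
import Summits.AnomalousDissipation.AnomalousDissipation.Theorems.DyadicWallCascadeViscousContinuationStubBlowDownOfFarField

/-!
# Stub `stub_farFieldIffViscousWallProfile` of line `Sketch`
# (crux stmt-AnomalousDissipation-17917, `DyadicWallCascade.ViscousContinuation`)

This file proves the registered stub `stub_farFieldIffViscousWallProfile` of line `Sketch` of the
crux stmt-AnomalousDissipation-17917 (`ViscousContinuation`) — the costume certificate of the line:
the FAR-FIELD form of the wall profile ("`(W, P) − (V, Q) → 0` uniformly as `z = X 2 → +∞`") is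
EQUIVALENT to the route's support decl `ViscousWallProfile` (item stmt-AnomalousDissipation-17919:
dyadic band blow-downs `(W, P) (2 ^ m • X) → (V, Q) X` uniformly on the band `1 ≤ X 2 ≤ 2`), given
the dilation invariance `(V, Q) (2 • X) = (V, Q) X` on `{X 2 > 0}` that sits inside the hierarchy
block of both statements.

* `→`: the landed sibling stub `stub_blowDownOfFarField` (far field + dilation invariance ⟹ band
  blow-down).
* `←` (`farFieldIff_farField_of_blowDown`): given `ε`, take `M` from the band clause and the
  threshold `Z := 2 ^ M`; for `X` with `2 ^ M ≤ X 2` pick `m` with `2 ^ m ≤ X 2 < 2 ^ (m + 1)`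
  (`exists_nat_pow_near`), so `M ≤ m`; put `Y := (2 ^ m)⁻¹ • X`, so `1 ≤ Y 2 ≤ 2`, `X = 2 ^ m • Y`
  and `(V, Q) X = (V, Q) Y` by iterated dilation invariance (`blowDown_iterate_invariance`); the band
  clause at `(m, Y)` is the bound.

The inlined clause block of the stub and the `let`-block of the route decl are definitionally equal,
so both directions destructure the witness and rebuild it component by component.
-/

-- adapted from Cruxes/ViscousContinuation/Disproof.lean §4 (cdisprove seat)

-- `Summit.<Summit>.<Problem>`: single-conjunct summit, the duplicate namespace is mandated (CONVENTIONS §2).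
set_option linter.dupNamespace false

noncomputable section

namespace Summit.AnomalousDissipation.AnomalousDissipation.Theorems

open Summit.AnomalousDissipation.AnomalousDissipation.Theses.DyadicWallCascade

/-- Euclidean 3-space (local notation, as in the registered skeleton). -/
local notation "E³" => EuclideanSpace ℝ (Fin 3)

/-- **Band blow-down ⟹ far-field convergence.** If `(V, Q)` is invariant under the dilation
`X ↦ 2 • X` on the open upper half-space `{X 2 > 0}` and the dyadic blow-downs `(W, P) (2 ^ m • X)`
converge to `(V, Q) X` uniformly on the band `1 ≤ X 2 ≤ 2`, then `(W, P) - (V, Q) → 0` uniformly as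
`X 2 → +∞`. [folklore] -/
theorem farFieldIff_farField_of_blowDown {W V : E³ → E³} {P Q : E³ → ℝ}
    (hdil : ∀ X : E³, 0 < X 2 → V ((2 : ℝ) • X) = V X ∧ Q ((2 : ℝ) • X) = Q X)
    (hbd : ∀ ε : ℝ, 0 < ε → ∃ M : ℕ, ∀ m : ℕ, M ≤ m → ∀ X : E³, 1 ≤ X 2 → X 2 ≤ 2 →
      ‖W ((2 : ℝ) ^ m • X) - V X‖ ≤ ε ∧ |P ((2 : ℝ) ^ m • X) - Q X| ≤ ε) :
    ∀ ε : ℝ, 0 < ε → ∃ Z : ℝ, ∀ X : E³, Z ≤ X 2 → ‖W X - V X‖ ≤ ε ∧ |P X - Q X| ≤ ε := by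
  intro ε hε
  obtain ⟨M, hM⟩ := hbd ε hε
  refine ⟨(2 : ℝ) ^ M, fun X hX => ?_⟩
  have h1X : 1 ≤ X 2 := le_trans (one_le_pow₀ (by norm_num)) hX
  obtain ⟨m, hm1, hm2⟩ := exists_nat_pow_near h1X (one_lt_two : (1 : ℝ) < 2)
  have hMm : M ≤ m := by
    by_contra h
    have h' : m + 1 ≤ M := by omega
    have : (2 : ℝ) ^ (m + 1) ≤ (2 : ℝ) ^ M := pow_le_pow_right₀ (by norm_num) h'
    linarith
  have h2m : (0 : ℝ) < (2 : ℝ) ^ m := by positivity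
  set Y : E³ := ((2 : ℝ) ^ m)⁻¹ • X with hY
  have hY2 : Y 2 = ((2 : ℝ) ^ m)⁻¹ * X 2 := by
    rw [hY, blowDown_smul_apply_two]
  have hY1 : 1 ≤ Y 2 := by
    rw [hY2, ← div_eq_inv_mul, le_div_iff₀ h2m]; simpa using hm1
  have hY2' : Y 2 ≤ 2 := by
    rw [hY2, ← div_eq_inv_mul, div_le_iff₀ h2m]
    calc X 2 ≤ (2 : ℝ) ^ (m + 1) := hm2.le
      _ = 2 * 2 ^ m := by ring
  have hYpos : 0 < Y 2 := lt_of_lt_of_le one_pos hY1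
  have hXY : X = (2 : ℝ) ^ m • Y := by
    rw [hY, smul_smul, mul_inv_cancel₀ h2m.ne', one_smul]
  obtain ⟨hW, hP⟩ := hM m hMm Y hY1 hY2'
  obtain ⟨hVd, hQd⟩ := blowDown_iterate_invariance V Q hdil m Y hYpos
  rw [hXY, hVd, hQd]
  exact ⟨hW, hP⟩

/-- **Stub `stub_farFieldIffViscousWallProfile` (line `Sketch`, crux stmt-AnomalousDissipation-17917)
— the far-field wall profile IS the viscous wall profile** (item stmt-AnomalousDissipation-17919,
decl `ViscousWallProfile`). `→`: `stub_blowDownOfFarField`; `←`: `farFieldIff_farField_of_blowDown`;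
in both directions the dilation invariance is the sixth clause of the hierarchy block. [folklore] -/
theorem stub_farFieldIffViscousWallProfile :
    (∃ (W : E³ → E³) (P : E³ → ℝ) (V : E³ → E³) (Q : E³ → ℝ) (C F C' : ℝ),
      (ContDiffOn ℝ ((⊤ : ℕ∞) : WithTop ℕ∞) V {X : E³ | 0 < X 2} ∧
        ContDiffOn ℝ ((⊤ : ℕ∞) : WithTop ℕ∞) Q {X : E³ | 0 < X 2} ∧
        (∀ X : E³, 0 < X 2 → ‖V X‖ ≤ C ∧ |Q X| ≤ C) ∧
        (∀ X : E³, 0 < X 2 → ∑ i : Fin 3, (fderiv ℝ V X (EuclideanSpace.single i (1 : ℝ))) i = 0) ∧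
        (∀ X : E³, 0 < X 2 → (fderiv ℝ V X) (V X) + gradient Q X = 0) ∧
        (∀ X : E³, 0 < X 2 → V ((2 : ℝ) • X) = V X ∧ Q ((2 : ℝ) • X) = Q X) ∧
        (∀ X : E³, 1 ≤ X 2 → X 2 ≤ 2 →
          V (X + EuclideanSpace.single 0 (1 : ℝ)) = V X ∧ V (X + EuclideanSpace.single 1 (1 : ℝ)) = V X ∧
          Q (X + EuclideanSpace.single 0 (1 : ℝ)) = Q X ∧ Q (X + EuclideanSpace.single 1 (1 : ℝ)) = Q X) ∧
        (∫ q in Set.Icc (0 : ℝ) 1 ×ˢ Set.Icc (0 : ℝ) 1, (V !₂[q.1, q.2, (1 : ℝ)]) 2 = 0) ∧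
        F ≠ 0 ∧
        (∫ q in Set.Icc (0 : ℝ) 1 ×ˢ Set.Icc (0 : ℝ) 1,
          (V !₂[q.1, q.2, (1 : ℝ)]) 2 * (‖V !₂[q.1, q.2, (1 : ℝ)]‖ ^ 2 / 2 + Q !₂[q.1, q.2, (1 : ℝ)]) = F)) ∧
      ContDiff ℝ ((⊤ : ℕ∞) : WithTop ℕ∞) W ∧ ContDiff ℝ ((⊤ : ℕ∞) : WithTop ℕ∞) P ∧
      (∀ X, ‖W X‖ ≤ C' ∧ |P X| ≤ C') ∧
      (∀ X : E³, W (X - (2 * X 2) • EuclideanSpace.single 2 (1 : ℝ)) =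
          W X - (2 * W X 2) • EuclideanSpace.single 2 (1 : ℝ) ∧
        P (X - (2 * X 2) • EuclideanSpace.single 2 (1 : ℝ)) = P X) ∧
      (∀ X : E³, ∑ i : Fin 3, (fderiv ℝ W X (EuclideanSpace.single i (1 : ℝ))) i = 0) ∧
      (∀ X : E³, (fderiv ℝ W X) (W X) + gradient P X =
        ∑ i : Fin 3, fderiv ℝ (fun Y => fderiv ℝ W Y (EuclideanSpace.single i (1 : ℝ))) X
          (EuclideanSpace.single i (1 : ℝ))) ∧
      (∀ ε : ℝ, 0 < ε → ∃ Z : ℝ, ∀ X : E³, Z ≤ X 2 → ‖W X - V X‖ ≤ ε ∧ |P X - Q X| ≤ ε)) ↔ ViscousWallProfile := by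
  constructor
  · rintro ⟨W, P, V, Q, C, F, C', hH, hWs, hPs, hWb, hmir, hWdiv, hNS, hfar⟩
    refine ⟨W, P, V, Q, C, F, C', hH, hWs, hPs, hWb, hmir, hWdiv, hNS, ?_⟩
    exact stub_blowDownOfFarField W V P Q (fun X hX => hH.2.2.2.2.2.1 X hX) hfar
  · rintro ⟨W, P, V, Q, C, F, C', hH, hWs, hPs, hWb, hmir, hWdiv, hNS, hbd⟩
    refine ⟨W, P, V, Q, C, F, C', hH, hWs, hPs, hWb, hmir, hWdiv, hNS, ?_⟩
    exact farFieldIff_farField_of_blowDown (fun X hX => hH.2.2.2.2.2.1 X hX) hbd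

end Summit.AnomalousDissipation.AnomalousDissipation.Theorems

end
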